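import Summits.Ventures.PercRepro.RankLevelSetLevelSixHeavyCell
import Summits.Ventures.PercRepro.RankLevelSetDepCountHeavySq
import Summits.Ventures.PercRepro.RankLevelSetLevelSix
import Summits.Ventures.PercRepro.S1FourCircuitCount
import Summits.Ventures.PercRepro.RankLevelSetPlaneSix
import Summits.Ventures.PercRepro.S1TriangleCount
import Summits.Ventures.PercRepro.RankLevelSetTriangleStar
import Summits.Ventures.PercRepro.RankLevelSetCorankFiveCounts
import Summits.Ventures.PercRepro.RankLevelSetPlaneTen
import Summits.Ventures.PercRepro.RankLevelSetPlaneTenPrime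
import Summits.Ventures.PercRepro.S1TrianglePlusPlus
import Summits.Ventures.PercRepro.RankLevelSetCoreFour
import Summits.Ventures.PercRepro.RankLevelSetFrameLarge
import Summits.Ventures.PercRepro.RankLevelSetFrameQM
import Summits.Ventures.PercRepro.RankLevelSetLevelFiveAll
import Summits.Ventures.PercRepro.RankLevelSetLevelSixGiant
import Summits.Ventures.PercRepro.RankLevelSetCoreSixLowSelf

/-!
# PercRepro — THE REGIME-II CELLS `(33, 52 … 55)` AND THE CORANK-`≥ 52` CELLS OF RANK `33` (p8 g4, S3; part A)

`proofs/SUBCLAIM-S3-p8.md` §3p. The corank regime of the level-`6` row at ranks `33 … 36`, SELF-CONTAINED over tree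
modules with oleans (RankLevelSetCoreSixLowSelf's device from `n₀ ≥ 89`, `core_six_corank_of_key_sub'`): at `p = 33, 34,
35, 36` the subtracted-term key `(2^{p+6} + 7700·C(p+6, p))·2^{33}·C(n, 6) ≤ C(p+6, p)·C(n, p − 1)` holds from `n₀ = 89`
(`key_six_sub_p_89'`, decided: slack `1.76 / 1.82 / 1.78 / 1.64`), so the cells `(p, d)` with `p + d ≥ 89` close by the
device; the cells between the counting route (`d ≤ 51`) and `n = 89` — `(33, 52 … 55)`, `(34, 52 … 54)`, `(35, 52 … 53)`,
`(36, 52)` — close by REGIME II WITH THE HEAVY-FREE COUNT (`c025_core_six_cell_regII_top'`, the cell theorem of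
RankLevelSetCoreSixLowSelfC restated here over LowSelf so that this module needs no un-built parent: `Y ≥ C(n, p − 1) −
#{r ≤ 6}`, `#{r ≤ 6} ≤ (Σ_{j ≤ 6} C(n, j))·2^{33}`, `U ≤ C(n, 6) + (σ₁² + σ₂²)·P(n)` at `ν₁ = 34` with LEMMA T⁺⁺ and T4 —
tree facts only; ratios `0.269 / 0.188 / 0.132 / 0.094`, `0.180 / 0.125 / 0.087`, `0.123 / 0.084`, `0.086`). Part A: the cell
theorem `c025_core_six_cell_regII_top'`, the four cells of rank `33`, the key at `p = 33` and **`c025_core_six_thirtythree_corank`**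
(`p = 33`, `d ≥ 52`); part B (RankLevelSetCoreSixLowSelfDB): ranks `34 … 36` and `c025_core_six_thirtynine_thirtythree'`.
Axioms: standard.
-/

open scoped Matroid

namespace PercRepro

namespace ThmN

open Set

variable {α : Type}

/-- **ONE CORE CELL AT LEVEL `6` IN REGIME II WITH THE HEAVY-FREE COUNT**: `Y ≥ C(n, p − 1) − #{r ≤ 6}`,
`#{r ≤ 6} ≤ (Σ_{j ≤ 6} C(n, j))·2^{33}`, `U ≤ C(n, 6) + (σ₁² + σ₂²)·P(n)` at `ν₁ = 34` (no heavy closure on the core),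
and the numeral `hpoly`: `2^{p+6}/C(p+6, 6)·U(n) + A(n) ≤ C(n, p − 1)`. -/
theorem c025_core_six_cell_regII_top' (M : Matroid α) [M.Finite] (p d : ℕ) (hd7 : 7 ≤ d) (hp : 1 ≤ p)
    (hR : M.eRank = (p : ℕ∞)) (hn : M.E.ncard = p + d)
    (hfree : ∀ e ∈ M.E, ∃ A ⊆ M.E \ {e}, e ∉ M.closure A ∧ e ∉ M.closure ((M.E \ {e}) \ A))
    (hpoly : ((2 : ℚ) ^ (p + 6) / (((p + 6).choose 6 : ℕ) : ℚ)) * ((((p + d).choose 6 : ℕ) : ℚ) +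
      ((∑ i ∈ Finset.range (d - 7 + 1), ((Nat.choose (min (min 19 (5 + d) - 6) (34 - 2)) i : ℕ) : ℚ) / (((i : ℚ) + 1) ^ 2)) *
        ((((d * d + 8 - 3 * d) / 2 : ℕ) : ℚ) * ((p + d).choose 4 : ℚ) + ((d * (d + 1) * (d + 2) / 3 : ℕ) : ℚ) * ((p + d).choose 3 : ℚ) +
          (((d + 4).choose 5 : ℕ) : ℚ) * ((p + d).choose 2 : ℚ) + (((d + 5).choose 6 : ℕ) : ℚ) * ((p + d : ℕ) : ℚ) +
          (((d + 6).choose 7 : ℕ) : ℚ)) +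
      (∑ i ∈ Finset.range (d - 7 + 1), ((Nat.choose (34 - 2) i : ℕ) : ℚ) / (((i : ℚ) + 1) ^ 2)) *
        ((((d * d + 8 - 3 * d) / 2 : ℕ) : ℚ) * ((p + d).choose 4 : ℚ) + ((d * (d + 1) * (d + 2) / 3 : ℕ) : ℚ) * ((p + d).choose 3 : ℚ) +
          (((d + 4).choose 5 : ℕ) : ℚ) * ((p + d).choose 2 : ℚ) + (((d + 5).choose 6 : ℕ) : ℚ) * ((p + d : ℕ) : ℚ) +
          (((d + 6).choose 7 : ℕ) : ℚ)))) +
      (((∑ j ∈ Finset.range (6 + 1), (p + d).choose j) : ℕ) : ℚ) * 2 ^ 33 ≤ (((p + d).choose (p - 1) : ℕ) : ℚ)) :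
    RLS M p 6 := by
  classical
  have hEcard : M.ground_finite.toFinset.card = p + d := by
    rw [← Set.ncard_eq_toFinset_card _ M.ground_finite]; exact hn
  -- the core is simple: every circuit has `≥ 3` elements
  have hL : ∀ e ∈ M.E, ¬ M.IsLoop e := not_isLoop_of_free M hfree
  have hs : ∀ e ∈ M.E, ∀ f ∈ M.E, e ≠ f → M.eRk {e, f} = 2 := by
    intro e he f hf hef
    have h2 : (2 : ℕ∞) ≤ M.eRk {e, f} :=
      two_le_eRk_of_two_le_ncard_of_free M hfree (pair_subset he hf) (by rw [ncard_pair hef])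
    have h3 : M.eRk {e, f} ≤ 2 := by
      have := M.eRk_le_encard {e, f}
      rwa [encard_pair hef] at this
    exact le_antisymm h3 h2
  have hcirc : ∀ C, M.IsCircuit C → 3 ≤ C.encard := three_le_encard_of_circuit M hL hs
  have hd : M.E.encard = M.eRank + d := by
    rw [hR, ← M.ground_finite.cast_ncard_eq, hn]
    push_cast
    ring
  -- the nullity cap: every `X ⊆ E` has `|X| ≤ r(X) + d`
  have hcap : ∀ X ⊆ M.E, ∀ k : ℕ, M.eRk X ≤ k → X.ncard ≤ k + d := by
    intro X hX k hr
    have h1 := Matroid.encard_le_eRk_add_of_encard_eq hX hd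
    have h2 : X.encard ≤ (k : ℕ∞) + d := h1.trans (by gcongr)
    have hfin : X.Finite := M.ground_finite.subset hX
    rw [← hfin.cast_ncard_eq] at h2
    exact_mod_cast h2
  have hflat : ∀ X ⊆ M.E, M.eRk X ≤ 6 → X.ncard ≤ min 39 (6 + d) :=
    fun X hX hr => le_min (ncard_le_thirtynine_of_eRk_le_six_of_free M hfree hX hr) (hcap X hX 6 hr)
  have hflat' : ∀ X ⊆ M.E, M.eRk X ≤ ((6 - 1 : ℕ) : ℕ∞) → X.ncard ≤ min 19 (5 + d) :=
    fun X hX hr => le_min (ncard_le_nineteen_of_eRk_le_five_of_free M hfree hX (by simpa using hr))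
      (hcap X hX 5 (by simpa using hr))
  -- (U): the heavy / light count
  have hU1 := Matroid.topCount_le_ncard_compl (M := M) hR hd 6
  have hG := Matroid.ncard_eRk_eq_ncard_le_le_heavy_sq M 6 (min 19 (5 + d)) 34 (by norm_num) hcirc d
  -- the pair classes
  have hPs : (((Matroid.pairsLight M 6 34).filter (fun p => p ∈ Matroid.pairsSmall M 6 (min 19 (5 + d)))).card : ℚ) ≤
      ∑ k ∈ Finset.Icc 3 (6 + 1), ({C | M.IsCircuit C ∧ C.ncard = k}.ncard : ℚ) * (M.E.ncard.choose (6 + 1 - k) : ℚ) := by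
    have h1 := (Matroid.card_pairsLightSmall_le (M := M) 6 (min 19 (5 + d)) 34).trans (Matroid.card_pairsF_le 6)
    have : ((((Matroid.pairsLight M 6 34).filter (fun p => p ∈ Matroid.pairsSmall M 6 (min 19 (5 + d)))).card : ℕ) : ℚ) ≤
        ((∑ k ∈ Finset.Icc 3 (6 + 1), {C | M.IsCircuit C ∧ C.ncard = k}.ncard * M.E.ncard.choose (6 + 1 - k) : ℕ) : ℚ) := by
      exact_mod_cast h1
    push_cast at this
    exact this
  have hPb : (((Matroid.pairsLight M 6 34).filter (fun p => p ∉ Matroid.pairsSmall M 6 (min 19 (5 + d)))).card : ℚ) ≤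
      ∑ k ∈ Finset.Icc 3 (6 + 1), ({C | M.IsCircuit C ∧ C.ncard = k}.ncard : ℚ) * (M.E.ncard.choose (6 + 1 - k) : ℚ) := by
    have h1 := (Matroid.card_pairsBigLight_le (M := M) 6 (min 19 (5 + d)) 34).trans (Matroid.card_pairsF_le 6)
    have : ((((Matroid.pairsLight M 6 34).filter (fun p => p ∉ Matroid.pairsSmall M 6 (min 19 (5 + d)))).card : ℕ) : ℚ) ≤
        ((∑ k ∈ Finset.Icc 3 (6 + 1), {C | M.IsCircuit C ∧ C.ncard = k}.ncard * M.E.ncard.choose (6 + 1 - k) : ℕ) : ℚ) := by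
      exact_mod_cast h1
    push_cast at this
    exact this
  -- the heavy sets: none (`ν₁ = 34`: a heavy closure would have `≥ 40` points)
  have hHv : ({B : Set α | B ⊆ M.E ∧ M.eRk B = (6 : ℕ) ∧ 6 + 34 ≤ (M.closure B).ncard}.ncard : ℚ) ≤ 0 := by
    have hempty : {B : Set α | B ⊆ M.E ∧ M.eRk B = (6 : ℕ) ∧ 6 + 34 ≤ (M.closure B).ncard} = ∅ := by
      ext B
      simp only [Set.mem_setOf_eq, Set.mem_empty_iff_false, iff_false]
      rintro ⟨hB, hr, hcl⟩
      have h39 : (M.closure B).ncard ≤ min 39 (6 + d) :=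
        hflat _ (M.closure_subset_ground B) (by rw [M.eRk_closure_eq]; exact hr.le)
      have : min 39 (6 + d) ≤ 39 := min_le_left _ _
      omega
    rw [hempty, Set.ncard_empty]
    simp
  -- the circuit bounds
  have hC1 : ∀ L ⊆ M.E, M.eRk L = 2 → L.ncard ≤ 3 :=
    fun L hL hr => ncard_le_three_of_eRk_two M hs hfree hL hr
  have hC2 : ∀ P ⊆ M.E, M.eRk P ≤ 3 → P.ncard ≤ 6 :=
    fun P hP hr => ncard_le_six_of_eRk_le_three_of_free M hfree hP hr
  have hs3 : {C | M.IsCircuit C ∧ C.ncard = 3}.ncard ≤ (d * d + 8 - 3 * d) / 2 :=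
    S1.ncard_triangles_le_of_nullity_plane M hC1 hC2 hd
  have hC1' : ∀ L ⊆ M.E, M.eRk L ≤ 2 → L.ncard ≤ 3 := by
    intro L hL' hr
    have := ncard_add_one_le_two_pow_of_eRk_le M hL hfree 2 L hL' hr
    omega
  have hs4 : {C | M.IsCircuit C ∧ C.ncard = 4}.ncard ≤ d * (d + 1) * (d + 2) / 3 := by
    have hT4 : 3 * {C : Set α | M.IsCircuit C ∧ C.ncard = 4}.ncard ≤ d * (d + 1) * (d + 2) :=
      S1.three_mul_ncard_four_circuits_le M hC1' hC2 hd
    omega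
  have hs5 : {C | M.IsCircuit C ∧ C.ncard = 5}.ncard ≤ (d + 4).choose 5 :=
    Matroid.ncard_circuits_le_choose_of_encard M hd 4
  have hs6 : {C | M.IsCircuit C ∧ C.ncard = 6}.ncard ≤ (d + 5).choose 6 :=
    Matroid.ncard_circuits_le_choose_of_encard M hd 5
  have hs7 : {C | M.IsCircuit C ∧ C.ncard = 7}.ncard ≤ (d + 6).choose 7 :=
    Matroid.ncard_circuits_le_choose_of_encard M hd 6
  have hs3q : ({C | M.IsCircuit C ∧ C.ncard = 3}.ncard : ℚ) ≤ (((d * d + 8 - 3 * d) / 2 : ℕ) : ℚ) := by exact_mod_cast hs3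
  have hs4q : ({C | M.IsCircuit C ∧ C.ncard = 4}.ncard : ℚ) ≤ ((d * (d + 1) * (d + 2) / 3 : ℕ) : ℚ) := by
    exact_mod_cast hs4
  have hs5q : ({C | M.IsCircuit C ∧ C.ncard = 5}.ncard : ℚ) ≤ (((d + 4).choose 5 : ℕ) : ℚ) := by exact_mod_cast hs5
  have hs6q : ({C | M.IsCircuit C ∧ C.ncard = 6}.ncard : ℚ) ≤ (((d + 5).choose 6 : ℕ) : ℚ) := by exact_mod_cast hs6
  have hs7q : ({C | M.IsCircuit C ∧ C.ncard = 7}.ncard : ℚ) ≤ (((d + 6).choose 7 : ℕ) : ℚ) := by exact_mod_cast hs7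
  -- the pair sum in explicit form
  have hPexp : ∑ k ∈ Finset.Icc 3 (6 + 1), ({C | M.IsCircuit C ∧ C.ncard = k}.ncard : ℚ) * (M.E.ncard.choose (6 + 1 - k) : ℚ) ≤
      (((d * d + 8 - 3 * d) / 2 : ℕ) : ℚ) * ((p + d).choose 4 : ℚ) + ((d * (d + 1) * (d + 2) / 3 : ℕ) : ℚ) * ((p + d).choose 3 : ℚ) +
        (((d + 4).choose 5 : ℕ) : ℚ) * ((p + d).choose 2 : ℚ) + (((d + 5).choose 6 : ℕ) : ℚ) * ((p + d : ℕ) : ℚ) +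
        (((d + 6).choose 7 : ℕ) : ℚ) := by
    rw [show (6 : ℕ) + 1 = 7 from rfl, sum_Icc_three_seven_q, hn]
    simp only [show (7 : ℕ) - 3 = 4 from rfl, show (7 : ℕ) - 4 = 3 from rfl, show (7 : ℕ) - 5 = 2 from rfl,
      show (7 : ℕ) - 6 = 1 from rfl, show (7 : ℕ) - 7 = 0 from rfl, Nat.choose_one_right, Nat.choose_zero_right,
      mul_one, Nat.cast_one]
    gcongr
  set Pq := (((d * d + 8 - 3 * d) / 2 : ℕ) : ℚ) * ((p + d).choose 4 : ℚ) + ((d * (d + 1) * (d + 2) / 3 : ℕ) : ℚ) * ((p + d).choose 3 : ℚ) +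
        (((d + 4).choose 5 : ℕ) : ℚ) * ((p + d).choose 2 : ℚ) + (((d + 5).choose 6 : ℕ) : ℚ) * ((p + d : ℕ) : ℚ) +
        (((d + 6).choose 7 : ℕ) : ℚ) with hPq
  have hσ1 : (0 : ℚ) ≤ ∑ i ∈ Finset.range (d - (6 + 1) + 1), ((Nat.choose (min (min 19 (5 + d) - 6) (34 - 2)) i : ℕ) : ℚ) / (((i : ℚ) + 1) ^ 2) :=
    Finset.sum_nonneg (fun i _ => by positivity)
  have hσ2 : (0 : ℚ) ≤ ∑ i ∈ Finset.range (d - (6 + 1) + 1), ((Nat.choose (34 - 2) i : ℕ) : ℚ) / (((i : ℚ) + 1) ^ 2) :=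
    Finset.sum_nonneg (fun i _ => by positivity)
  have hUq : (Matroid.topCount M p 6 : ℚ) ≤ ((p + d).choose 6 : ℚ) +
      ((∑ i ∈ Finset.range (d - 7 + 1), ((Nat.choose (min (min 19 (5 + d) - 6) (34 - 2)) i : ℕ) : ℚ) / (((i : ℚ) + 1) ^ 2)) * Pq +
        (∑ i ∈ Finset.range (d - 7 + 1), ((Nat.choose (34 - 2) i : ℕ) : ℚ) / (((i : ℚ) + 1) ^ 2)) * Pq) := by
    have h1 : (Matroid.topCount M p 6 : ℚ) ≤
        ({B : Set α | B ⊆ M.E ∧ M.eRk B = 6 ∧ B.ncard ≤ d}.ncard : ℚ) := by exact_mod_cast hU1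
    refine h1.trans (hG.trans ?_)
    have e1 := mul_le_mul_of_nonneg_left (hPs.trans hPexp) hσ1
    have e2 := mul_le_mul_of_nonneg_left (hPb.trans hPexp) hσ2
    simp only [show (6 : ℕ) + 1 = 7 from rfl] at e1 e2 ⊢
    rw [hn]
    have h3 := add_le_add (add_le_add (add_le_add (le_refl (((p + d).choose 6 : ℕ) : ℚ)) e1) e2) hHv
    refine h3.trans (le_of_eq ?_)
    ring
  -- (Y): regime II, the rank-`≤ 6` sets subtracted from the `(p − 1)`-subsets
  have hBj : ∀ j : ℕ, j ≤ 6 → ∀ X ⊆ M.E, M.eRk X ≤ j → X.ncard + 6 ≤ 39 + j := by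
    intro j hj X hX hr
    rcases Nat.lt_or_ge j 4 with h | h
    · have := ncard_add_one_le_two_pow_of_eRk_le M hL hfree j X hX hr
      interval_cases j <;> omega
    · rcases Nat.lt_or_ge j 5 with h5 | h5
      · have hj4 : j = 4 := by omega
        subst hj4
        have := ncard_le_ten_of_eRk_le_four_of_free M hfree hX hr
        omega
      · rcases Nat.lt_or_ge j 6 with h6 | h6
        · have hj5 : j = 5 := by omega
          subst hj5
          have := ncard_le_nineteen_of_eRk_le_five_of_free M hfree hX hr
          omega
        · have hj6 : j = 6 := by omega
          subst hj6
          have := ncard_le_thirtynine_of_eRk_le_six_of_free M hfree hX hr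
          omega
  have hA := ncard_eRk_le_le_sum_choose_mul_of_bound M 6 39 hBj
  rw [hEcard] at hA
  have hY := choose_le_midCount_add_low' (M := M) (p := p) (q := 6) hp
  rw [hEcard] at hY
  have hΦ := phiK_le_two_pow_div p 6
  rw [Nat.choose_symm_add] at hΦ
  rw [RLS_iff]
  have hYq : (((p + d).choose (p - 1) : ℕ) : ℚ) ≤ (Matroid.midCount M p 6 : ℚ) +
      ({X : Set α | X ⊆ M.E ∧ M.eRk X ≤ 6}.ncard : ℚ) := by exact_mod_cast hY
  have hAq : ({X : Set α | X ⊆ M.E ∧ M.eRk X ≤ 6}.ncard : ℚ) ≤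
      (((∑ j ∈ Finset.range (6 + 1), (p + d).choose j) : ℕ) : ℚ) * 2 ^ 33 := by
    have : ({X : Set α | X ⊆ M.E ∧ M.eRk X ≤ 6}.ncard : ℚ) ≤
        (((∑ j ∈ Finset.range (6 + 1), (p + d).choose j) * 2 ^ (39 - 6) : ℕ) : ℚ) := by exact_mod_cast hA
    push_cast at this
    norm_num at this ⊢
    exact this
  have hU0 : (0 : ℚ) ≤ (Matroid.topCount M p 6 : ℚ) := Nat.cast_nonneg _
  have hΦ0 : (0 : ℚ) ≤ (2 ^ (p + 6) : ℚ) / (((p + 6).choose 6 : ℕ) : ℚ) := by positivity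
  calc phiK p 6 * (Matroid.topCount M p 6 : ℚ)
      ≤ ((2 ^ (p + 6) : ℚ) / (((p + 6).choose 6 : ℕ) : ℚ)) * (((p + d).choose 6 : ℚ) +
          ((∑ i ∈ Finset.range (d - 7 + 1), ((Nat.choose (min (min 19 (5 + d) - 6) (34 - 2)) i : ℕ) : ℚ) / (((i : ℚ) + 1) ^ 2)) * Pq +
            (∑ i ∈ Finset.range (d - 7 + 1), ((Nat.choose (34 - 2) i : ℕ) : ℚ) / (((i : ℚ) + 1) ^ 2)) * Pq)) :=
        mul_le_mul hΦ hUq hU0 hΦ0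
    _ ≤ (((p + d).choose (p - 1) : ℕ) : ℚ) - (((∑ j ∈ Finset.range (6 + 1), (p + d).choose j) : ℕ) : ℚ) * 2 ^ 33 := by
        rw [hPq]; linarith [hpoly]
    _ ≤ (Matroid.midCount M p 6 : ℚ) := by linarith

/-- The numeral of the cell `(33, 52)`: `2^{39}/C(39, 6)·U(85) + A(85) ≤ C(85, 32)`. -/
theorem cell_33_52_numeral' :
    ((2 : ℚ) ^ (33 + 6) / (((33 + 6).choose 6 : ℕ) : ℚ)) * ((((33 + 52).choose 6 : ℕ) : ℚ) +
      ((∑ i ∈ Finset.range (52 - 7 + 1), ((Nat.choose (min (min 19 (5 + 52) - 6) (34 - 2)) i : ℕ) : ℚ) / (((i : ℚ) + 1) ^ 2)) *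
        ((((52 * 52 + 8 - 3 * 52) / 2 : ℕ) : ℚ) * ((33 + 52).choose 4 : ℚ) + ((52 * (52 + 1) * (52 + 2) / 3 : ℕ) : ℚ) * ((33 + 52).choose 3 : ℚ) +
          (((52 + 4).choose 5 : ℕ) : ℚ) * ((33 + 52).choose 2 : ℚ) + (((52 + 5).choose 6 : ℕ) : ℚ) * ((33 + 52 : ℕ) : ℚ) +
          (((52 + 6).choose 7 : ℕ) : ℚ)) +
      (∑ i ∈ Finset.range (52 - 7 + 1), ((Nat.choose (34 - 2) i : ℕ) : ℚ) / (((i : ℚ) + 1) ^ 2)) *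
        ((((52 * 52 + 8 - 3 * 52) / 2 : ℕ) : ℚ) * ((33 + 52).choose 4 : ℚ) + ((52 * (52 + 1) * (52 + 2) / 3 : ℕ) : ℚ) * ((33 + 52).choose 3 : ℚ) +
          (((52 + 4).choose 5 : ℕ) : ℚ) * ((33 + 52).choose 2 : ℚ) + (((52 + 5).choose 6 : ℕ) : ℚ) * ((33 + 52 : ℕ) : ℚ) +
          (((52 + 6).choose 7 : ℕ) : ℚ)))) +
      (((∑ j ∈ Finset.range (6 + 1), (33 + 52).choose j) : ℕ) : ℚ) * 2 ^ 33 ≤ (((33 + 52).choose (33 - 1) : ℕ) : ℚ) := by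
  have hσ1 : (∑ i ∈ Finset.range (52 - 7 + 1), ((Nat.choose (min (min 19 (5 + 52) - 6) (34 - 2)) i : ℕ) : ℚ) / (((i : ℚ) + 1) ^ 2)) =
      (∑ i ∈ Finset.range (52 - 7 + 1), ((Nat.choose 13 i : ℕ) : ℚ) / (((i : ℚ) + 1) ^ 2)) := by
    norm_num
  have hσ2 : (∑ i ∈ Finset.range (52 - 7 + 1), ((Nat.choose (34 - 2) i : ℕ) : ℚ) / (((i : ℚ) + 1) ^ 2)) =
      (∑ i ∈ Finset.range (52 - 7 + 1), ((Nat.choose 32 i : ℕ) : ℚ) / (((i : ℚ) + 1) ^ 2)) := by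
    norm_num
  rw [hσ1, hσ2]
  simp only [Finset.sum_range_succ, Finset.sum_range_zero]
  norm_num [Nat.choose]

/-- **The cell `(33, 52)`.** -/
theorem c025_core_six_cell_33_52' (M : Matroid α) [M.Finite] (hR : M.eRank = (33 : ℕ∞)) (hn : M.E.ncard = 33 + 52)
    (hfree : ∀ e ∈ M.E, ∃ A ⊆ M.E \ {e}, e ∉ M.closure A ∧ e ∉ M.closure ((M.E \ {e}) \ A)) : RLS M 33 6 :=
  c025_core_six_cell_regII_top' M 33 52 (by norm_num) (by norm_num) hR hn hfree cell_33_52_numeral'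

/-- The numeral of the cell `(33, 53)`: `2^{39}/C(39, 6)·U(86) + A(86) ≤ C(86, 32)`. -/
theorem cell_33_53_numeral' :
    ((2 : ℚ) ^ (33 + 6) / (((33 + 6).choose 6 : ℕ) : ℚ)) * ((((33 + 53).choose 6 : ℕ) : ℚ) +
      ((∑ i ∈ Finset.range (53 - 7 + 1), ((Nat.choose (min (min 19 (5 + 53) - 6) (34 - 2)) i : ℕ) : ℚ) / (((i : ℚ) + 1) ^ 2)) *
        ((((53 * 53 + 8 - 3 * 53) / 2 : ℕ) : ℚ) * ((33 + 53).choose 4 : ℚ) + ((53 * (53 + 1) * (53 + 2) / 3 : ℕ) : ℚ) * ((33 + 53).choose 3 : ℚ) +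
          (((53 + 4).choose 5 : ℕ) : ℚ) * ((33 + 53).choose 2 : ℚ) + (((53 + 5).choose 6 : ℕ) : ℚ) * ((33 + 53 : ℕ) : ℚ) +
          (((53 + 6).choose 7 : ℕ) : ℚ)) +
      (∑ i ∈ Finset.range (53 - 7 + 1), ((Nat.choose (34 - 2) i : ℕ) : ℚ) / (((i : ℚ) + 1) ^ 2)) *
        ((((53 * 53 + 8 - 3 * 53) / 2 : ℕ) : ℚ) * ((33 + 53).choose 4 : ℚ) + ((53 * (53 + 1) * (53 + 2) / 3 : ℕ) : ℚ) * ((33 + 53).choose 3 : ℚ) +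
          (((53 + 4).choose 5 : ℕ) : ℚ) * ((33 + 53).choose 2 : ℚ) + (((53 + 5).choose 6 : ℕ) : ℚ) * ((33 + 53 : ℕ) : ℚ) +
          (((53 + 6).choose 7 : ℕ) : ℚ)))) +
      (((∑ j ∈ Finset.range (6 + 1), (33 + 53).choose j) : ℕ) : ℚ) * 2 ^ 33 ≤ (((33 + 53).choose (33 - 1) : ℕ) : ℚ) := by
  have hσ1 : (∑ i ∈ Finset.range (53 - 7 + 1), ((Nat.choose (min (min 19 (5 + 53) - 6) (34 - 2)) i : ℕ) : ℚ) / (((i : ℚ) + 1) ^ 2)) =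
      (∑ i ∈ Finset.range (53 - 7 + 1), ((Nat.choose 13 i : ℕ) : ℚ) / (((i : ℚ) + 1) ^ 2)) := by
    norm_num
  have hσ2 : (∑ i ∈ Finset.range (53 - 7 + 1), ((Nat.choose (34 - 2) i : ℕ) : ℚ) / (((i : ℚ) + 1) ^ 2)) =
      (∑ i ∈ Finset.range (53 - 7 + 1), ((Nat.choose 32 i : ℕ) : ℚ) / (((i : ℚ) + 1) ^ 2)) := by
    norm_num
  rw [hσ1, hσ2]
  simp only [Finset.sum_range_succ, Finset.sum_range_zero]
  norm_num [Nat.choose]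

/-- **The cell `(33, 53)`.** -/
theorem c025_core_six_cell_33_53' (M : Matroid α) [M.Finite] (hR : M.eRank = (33 : ℕ∞)) (hn : M.E.ncard = 33 + 53)
    (hfree : ∀ e ∈ M.E, ∃ A ⊆ M.E \ {e}, e ∉ M.closure A ∧ e ∉ M.closure ((M.E \ {e}) \ A)) : RLS M 33 6 :=
  c025_core_six_cell_regII_top' M 33 53 (by norm_num) (by norm_num) hR hn hfree cell_33_53_numeral'

/-- The numeral of the cell `(33, 54)`: `2^{39}/C(39, 6)·U(87) + A(87) ≤ C(87, 32)`. -/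
theorem cell_33_54_numeral' :
    ((2 : ℚ) ^ (33 + 6) / (((33 + 6).choose 6 : ℕ) : ℚ)) * ((((33 + 54).choose 6 : ℕ) : ℚ) +
      ((∑ i ∈ Finset.range (54 - 7 + 1), ((Nat.choose (min (min 19 (5 + 54) - 6) (34 - 2)) i : ℕ) : ℚ) / (((i : ℚ) + 1) ^ 2)) *
        ((((54 * 54 + 8 - 3 * 54) / 2 : ℕ) : ℚ) * ((33 + 54).choose 4 : ℚ) + ((54 * (54 + 1) * (54 + 2) / 3 : ℕ) : ℚ) * ((33 + 54).choose 3 : ℚ) +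
          (((54 + 4).choose 5 : ℕ) : ℚ) * ((33 + 54).choose 2 : ℚ) + (((54 + 5).choose 6 : ℕ) : ℚ) * ((33 + 54 : ℕ) : ℚ) +
          (((54 + 6).choose 7 : ℕ) : ℚ)) +
      (∑ i ∈ Finset.range (54 - 7 + 1), ((Nat.choose (34 - 2) i : ℕ) : ℚ) / (((i : ℚ) + 1) ^ 2)) *
        ((((54 * 54 + 8 - 3 * 54) / 2 : ℕ) : ℚ) * ((33 + 54).choose 4 : ℚ) + ((54 * (54 + 1) * (54 + 2) / 3 : ℕ) : ℚ) * ((33 + 54).choose 3 : ℚ) +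
          (((54 + 4).choose 5 : ℕ) : ℚ) * ((33 + 54).choose 2 : ℚ) + (((54 + 5).choose 6 : ℕ) : ℚ) * ((33 + 54 : ℕ) : ℚ) +
          (((54 + 6).choose 7 : ℕ) : ℚ)))) +
      (((∑ j ∈ Finset.range (6 + 1), (33 + 54).choose j) : ℕ) : ℚ) * 2 ^ 33 ≤ (((33 + 54).choose (33 - 1) : ℕ) : ℚ) := by
  have hσ1 : (∑ i ∈ Finset.range (54 - 7 + 1), ((Nat.choose (min (min 19 (5 + 54) - 6) (34 - 2)) i : ℕ) : ℚ) / (((i : ℚ) + 1) ^ 2)) =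
      (∑ i ∈ Finset.range (54 - 7 + 1), ((Nat.choose 13 i : ℕ) : ℚ) / (((i : ℚ) + 1) ^ 2)) := by
    norm_num
  have hσ2 : (∑ i ∈ Finset.range (54 - 7 + 1), ((Nat.choose (34 - 2) i : ℕ) : ℚ) / (((i : ℚ) + 1) ^ 2)) =
      (∑ i ∈ Finset.range (54 - 7 + 1), ((Nat.choose 32 i : ℕ) : ℚ) / (((i : ℚ) + 1) ^ 2)) := by
    norm_num
  rw [hσ1, hσ2]
  simp only [Finset.sum_range_succ, Finset.sum_range_zero]
  norm_num [Nat.choose]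

/-- **The cell `(33, 54)`.** -/
theorem c025_core_six_cell_33_54' (M : Matroid α) [M.Finite] (hR : M.eRank = (33 : ℕ∞)) (hn : M.E.ncard = 33 + 54)
    (hfree : ∀ e ∈ M.E, ∃ A ⊆ M.E \ {e}, e ∉ M.closure A ∧ e ∉ M.closure ((M.E \ {e}) \ A)) : RLS M 33 6 :=
  c025_core_six_cell_regII_top' M 33 54 (by norm_num) (by norm_num) hR hn hfree cell_33_54_numeral'

/-- The numeral of the cell `(33, 55)`: `2^{39}/C(39, 6)·U(88) + A(88) ≤ C(88, 32)`. -/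
theorem cell_33_55_numeral' :
    ((2 : ℚ) ^ (33 + 6) / (((33 + 6).choose 6 : ℕ) : ℚ)) * ((((33 + 55).choose 6 : ℕ) : ℚ) +
      ((∑ i ∈ Finset.range (55 - 7 + 1), ((Nat.choose (min (min 19 (5 + 55) - 6) (34 - 2)) i : ℕ) : ℚ) / (((i : ℚ) + 1) ^ 2)) *
        ((((55 * 55 + 8 - 3 * 55) / 2 : ℕ) : ℚ) * ((33 + 55).choose 4 : ℚ) + ((55 * (55 + 1) * (55 + 2) / 3 : ℕ) : ℚ) * ((33 + 55).choose 3 : ℚ) +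
          (((55 + 4).choose 5 : ℕ) : ℚ) * ((33 + 55).choose 2 : ℚ) + (((55 + 5).choose 6 : ℕ) : ℚ) * ((33 + 55 : ℕ) : ℚ) +
          (((55 + 6).choose 7 : ℕ) : ℚ)) +
      (∑ i ∈ Finset.range (55 - 7 + 1), ((Nat.choose (34 - 2) i : ℕ) : ℚ) / (((i : ℚ) + 1) ^ 2)) *
        ((((55 * 55 + 8 - 3 * 55) / 2 : ℕ) : ℚ) * ((33 + 55).choose 4 : ℚ) + ((55 * (55 + 1) * (55 + 2) / 3 : ℕ) : ℚ) * ((33 + 55).choose 3 : ℚ) +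
          (((55 + 4).choose 5 : ℕ) : ℚ) * ((33 + 55).choose 2 : ℚ) + (((55 + 5).choose 6 : ℕ) : ℚ) * ((33 + 55 : ℕ) : ℚ) +
          (((55 + 6).choose 7 : ℕ) : ℚ)))) +
      (((∑ j ∈ Finset.range (6 + 1), (33 + 55).choose j) : ℕ) : ℚ) * 2 ^ 33 ≤ (((33 + 55).choose (33 - 1) : ℕ) : ℚ) := by
  have hσ1 : (∑ i ∈ Finset.range (55 - 7 + 1), ((Nat.choose (min (min 19 (5 + 55) - 6) (34 - 2)) i : ℕ) : ℚ) / (((i : ℚ) + 1) ^ 2)) =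
      (∑ i ∈ Finset.range (55 - 7 + 1), ((Nat.choose 13 i : ℕ) : ℚ) / (((i : ℚ) + 1) ^ 2)) := by
    norm_num
  have hσ2 : (∑ i ∈ Finset.range (55 - 7 + 1), ((Nat.choose (34 - 2) i : ℕ) : ℚ) / (((i : ℚ) + 1) ^ 2)) =
      (∑ i ∈ Finset.range (55 - 7 + 1), ((Nat.choose 32 i : ℕ) : ℚ) / (((i : ℚ) + 1) ^ 2)) := by
    norm_num
  rw [hσ1, hσ2]
  simp only [Finset.sum_range_succ, Finset.sum_range_zero]
  norm_num [Nat.choose]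

/-- **The cell `(33, 55)`.** -/
theorem c025_core_six_cell_33_55' (M : Matroid α) [M.Finite] (hR : M.eRank = (33 : ℕ∞)) (hn : M.E.ncard = 33 + 55)
    (hfree : ∀ e ∈ M.E, ∃ A ⊆ M.E \ {e}, e ∉ M.closure A ∧ e ∉ M.closure ((M.E \ {e}) \ A)) : RLS M 33 6 :=
  c025_core_six_cell_regII_top' M 33 55 (by norm_num) (by norm_num) hR hn hfree cell_33_55_numeral'

/-- The key with the subtracted term at `p = 33`, `n = 89` — one numeral, decided. -/
theorem key_six_sub_33_89' :
    (2 ^ 39 + 7700 * Nat.choose 39 33) * 2 ^ 33 * Nat.choose 89 6 ≤ Nat.choose 39 33 * Nat.choose 89 32 := by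
  decide

/-- **The `e`-free core at level `6`, rank `33`, every corank `≥ 52`** (the four regime-II cells up to `n = 88`, the key at
`n₀ = 89`). -/
theorem c025_core_six_thirtythree_corank (M : Matroid α) [M.Finite]
    (hR : M.eRank = (33 : ℕ∞)) (hbig : 33 + 51 < M.E.ncard)
    (hfree : ∀ e ∈ M.E, ∃ A ⊆ M.E \ {e}, e ∉ M.closure A ∧ e ∉ M.closure ((M.E \ {e}) \ A)) : RLS M 33 6 := by
  rcases Nat.lt_or_ge M.E.ncard 89 with hsmall | hbig89
  · rcases Nat.lt_or_ge M.E.ncard 86 with h | h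
    · exact c025_core_six_cell_33_52' M hR (by omega) hfree
    rcases Nat.lt_or_ge M.E.ncard 87 with h' | h'
    · exact c025_core_six_cell_33_53' M hR (by omega) hfree
    rcases Nat.lt_or_ge M.E.ncard 88 with h'' | h''
    · exact c025_core_six_cell_33_54' M hR (by omega) hfree
    · exact c025_core_six_cell_33_55' M hR (by omega) hfree
  · refine core_six_corank_of_key_sub' 89 le_rfl M 33 (by norm_num) ?_ (by omega) hfree
    have hk := key_of_base' 33 6 ((2 ^ 39 + 7700 * Nat.choose 39 33) * 2 ^ 33) (Nat.choose 39 33) 89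
      (by norm_num) (by norm_num) (by norm_num) key_six_sub_33_89'
    intro n hn
    have := hk n hn
    simpa using this

end ThmN

end PercRepro
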